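import Summits.Ventures.Crystal3D.Theorems.StickyWulffConstantGenericWallFloorNearIdentityCore
import Mathlib.Data.Finset.Card
import Mathlib.Data.Fintype.Powerset
import HarnessLib

/-!
# Near-identity cap lemma for mixed kissing dozens, part 2: cut normals of the cuboctahedron and the
# Σ1 cap lemma in the cubic frame (module M7 of the rigid rung)

HONEST FRAMING. Part of the venture `Summits/Ventures/Crystal3D` (cell `crystal3d-full`), helper
`--supports` the crux `GenericWallFloor` (stmt-Ventures-19480, `route-Ventures-StickyWulffConstant`),
REGISTERED line `WallLedgerG`, stub `stub_twoSlabAdhesion`, rigid-bicrystal rung, module M7 (coincidence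
top sites), Σ1 part — continues `…GenericWallFloorNearIdentityCore`.  Rung credit only.

The twelve slots of the cuboctahedron in the cubic frame are the `(±1,±1,0)`-type vectors `/√2`
(`slotInt`, `slotVec`); the normal `w × o` of a CUT EDGE (own slot `o`, empty adjacent slot `w`) is half a
cube vertex `(±1,±1,±1)` (`cutTriples`, `cut_real`).  Kernel-decided combinatorial core (`good_all`,
`decide +kernel` over the `3938` own-sets `S ⊆ Fin 12` with `3 ≤ #S ≤ 9`): the cut normals of `S`
contain a REGULAR TETRAHEDRON of cube vertices (`{0,3,5,6}` or `{7,4,2,1}`) or a `6`-ANTIPRISM (all but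
an antipodal pair).  With the tetrahedral frame inequality (`tetra_cube`, `antiprism_cube`: for every
`a ∈ ℝ³` such a set contains `t` with `a ⬝ t̂ ≥ |a|/3`) and part 1 this gives

**`near_identity_cut` (Σ1 cap lemma, matrix form).**  If `1 + κ` is orthogonal with
`0 < ‖κ‖_F² ≤ 1/9` and `S ⊆ Fin 12`, `3 ≤ #S ≤ 9`, then some own slot `o ∈ S` and some adjacent EMPTY
slot `w ∉ S` satisfy `o ⬝ (1 + κ) w > ½ = o ⬝ w`.  Reading: at a coincidence site of a rigid bicrystal
whose misorientation is within `≈ 13.5°` of (but not equal to) a lattice symmetry, a ball with `3…9`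
own neighbours cannot be saturated by foreign balls on the rotated empty slots — they would overlap an
own neighbour.  (The lattice packaging — `A₁, A₂, fccSlots`, the reduction
`four_le_card_empty_of_saturated_coincidence_top` — is the next file.)
WHAT THIS IS NOT: the Σ3 cap, the global part of M7, the packaging to `TwoSlabAdhesion`'s vocabulary;
rung F-C1 not moved.
-/

noncomputable section

namespace Summit.Ventures.Crystal3D.Theorems.NearIdentity

open Matrix

/-- The twelve slots of the cuboctahedron in the cubic frame, as integer triples (`(±1,±1,0)`-type). -/
def slotInt : Fin 12 → Fin 3 → ℤ := ![![1, 1, 0], ![1, -1, 0], ![-1, 1, 0], ![-1, -1, 0], ![1, 0, 1], ![1, 0, -1], ![-1, 0, 1], ![-1, 0, -1], ![0, 1, 1], ![0, 1, -1], ![0, -1, 1], ![0, -1, -1]]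

/-- The eight cube vertices `(±1,±1,±1)`, indexed so that `7 − c` is the antipode of `c`. -/
def cubeInt : Fin 8 → Fin 3 → ℤ := ![![1, 1, 1], ![1, 1, -1], ![1, -1, 1], ![1, -1, -1], ![-1, 1, 1], ![-1, 1, -1], ![-1, -1, 1], ![-1, -1, -1]]

/-- Integer cross product (componentwise formula). -/
def crossInt (x y : Fin 3 → ℤ) : Fin 3 → ℤ :=
  ![x 1 * y 2 - x 2 * y 1, x 2 * y 0 - x 0 * y 2, x 0 * y 1 - x 1 * y 0]

/-- The 48 ordered ADJACENT slot pairs `(o, w)` together with the index `c` of the cube vertex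
`slot w × slot o` (the normal of the cut edge `o → w`). -/
def cutTriples : List (Fin 12 × Fin 12 × Fin 8) := [(0, 4, 4), (0, 5, 2), (0, 8, 5), (0, 9, 3), (1, 4, 1), (1, 5, 7), (1, 10, 0), (1, 11, 6), (2, 6, 7), (2, 7, 1), (2, 8, 6), (2, 9, 0), (3, 6, 2), (3, 7, 4), (3, 10, 3), (3, 11, 5), (4, 0, 3), (4, 1, 6), (4, 8, 1), (4, 10, 4), (5, 0, 5), (5, 1, 0), (5, 9, 7), (5, 11, 2), (6, 2, 0), (6, 3, 5), (6, 8, 2), (6, 10, 7), (7, 2, 6), (7, 3, 3), (7, 9, 4), (7, 11, 1), (8, 0, 2), (8, 2, 1), (8, 4, 6), (8, 6, 5), (9, 0, 4), (9, 2, 7), (9, 5, 0), (9, 7, 3), (10, 1, 7), (10, 3, 4), (10, 4, 3), (10, 6, 0), (11, 1, 1), (11, 3, 2), (11, 5, 5), (11, 7, 6)]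

/-- Table check (kernel-decided): every cut triple is an adjacent pair with the recorded cross product,
and every slot has integer norm² `2`. -/
theorem cutTriples_facts :
    (∀ t ∈ cutTriples, slotInt t.1 ⬝ᵥ slotInt t.2.1 = 1 ∧ crossInt (slotInt t.2.1) (slotInt t.1) = cubeInt t.2.2) ∧
    (∀ k : Fin 12, slotInt k ⬝ᵥ slotInt k = 2) := by
  decide +kernel

/-- the list of cut-normal indices of an own-set `S ⊆ Fin 12` (with repetitions). -/
def cutList (S : Finset (Fin 12)) : List (Fin 8) :=
  cutTriples.filterMap fun t => if t.1 ∈ S ∧ t.2.1 ∉ S then some t.2.2 else none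

/-- **Combinatorial core — TETRAHEDRON-OR-ANTIPRISM (kernel-decided over all `3938` own-sets).**
For every `S ⊆ Fin 12` with `3 ≤ #S ≤ 9` the cut normals of `S` contain the regular tetrahedron
`{0,3,5,6}` of cube vertices, or the tetrahedron `{7,4,2,1}`, or all cube vertices except one antipodal
pair `{v, 7 − v}` (a `6`-antiprism). -/
theorem good_all : ∀ S : Finset (Fin 12), 3 ≤ S.card → S.card ≤ 9 →
    ((∀ c ∈ ([0, 3, 5, 6] : List (Fin 8)), c ∈ cutList S) ∨ (∀ c ∈ ([7, 4, 2, 1] : List (Fin 8)), c ∈ cutList S) ∨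
      (∃ v : Fin 4, ∀ c : Fin 8, c.val ≠ v.val → c.val ≠ 7 - v.val → c ∈ cutList S)) := by
  decide +kernel

/-- A cut-normal index present for `S` comes from an own slot `o ∈ S` and an adjacent empty `w ∉ S`. -/
theorem mem_cutList {S : Finset (Fin 12)} {c : Fin 8} (h : c ∈ cutList S) :
    ∃ o w : Fin 12, (o, w, c) ∈ cutTriples ∧ o ∈ S ∧ w ∉ S := by
  unfold cutList at h
  simp only [List.mem_filterMap, Option.ite_none_right_eq_some, Option.some.injEq, Prod.exists] at h
  obtain ⟨o, w, c', hmem, ⟨ho, hw⟩, rfl⟩ := h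
  exact ⟨o, w, hmem, ho, hw⟩

/-! ### Real vectors -/

/-- The slot `k` as a unit vector of `ℝ³` (cubic frame). -/
def slotVec (k : Fin 12) : Fin 3 → ℝ := fun i => (slotInt k i : ℝ) / Real.sqrt 2

/-- The cube vertex `c` as a vector of `ℝ³` (norm `√3`). -/
def cubeVec (c : Fin 8) : Fin 3 → ℝ := fun i => (cubeInt c i : ℝ)

/-- Slots are unit vectors. -/
theorem slotVec_dot_self (k : Fin 12) : slotVec k ⬝ᵥ slotVec k = 1 := by
  have h := cutTriples_facts.2 k
  have h2 : (2 : ℝ) = ((slotInt k ⬝ᵥ slotInt k : ℤ) : ℝ) := by rw [h]; norm_num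
  simp only [dotProduct, Fin.sum_univ_three] at h2 ⊢
  simp only [slotVec]
  push_cast at h2
  have hs : Real.sqrt 2 ^ 2 = 2 := Real.sq_sqrt (by norm_num)
  field_simp
  nlinarith [h2, hs]

/-- Real form of a cut triple: `o ⬝ w = ½` and `w × o = ½ · (cube vertex c)`. -/
theorem cut_real {o w : Fin 12} {c : Fin 8} (h : (o, w, c) ∈ cutTriples) :
    slotVec o ⬝ᵥ slotVec w = 1 / 2 ∧ crossProduct (slotVec w) (slotVec o) = (1 / 2 : ℝ) • cubeVec c := by
  obtain ⟨hd, hc⟩ := (cutTriples_facts.1 _ h)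
  simp only at hd hc
  have hs : Real.sqrt 2 ^ 2 = 2 := Real.sq_sqrt (by norm_num)
  have hs0 : Real.sqrt 2 ≠ 0 := by positivity
  constructor
  · have h2 : (1 : ℝ) = ((slotInt o ⬝ᵥ slotInt w : ℤ) : ℝ) := by rw [hd]; norm_num
    simp only [dotProduct, Fin.sum_univ_three] at h2 ⊢
    simp only [slotVec]
    push_cast at h2
    field_simp
    nlinarith [h2, hs]
  · have e0 := congrFun hc 0
    have e1 := congrFun hc 1
    have e2 := congrFun hc 2
    simp only [crossInt, Matrix.cons_val_zero, Matrix.cons_val_one, Matrix.head_cons, Matrix.cons_val_two,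
      Matrix.tail_cons] at e0 e1 e2
    ext i
    fin_cases i <;>
      simp only [cross_apply, slotVec, cubeVec, Pi.smul_apply, smul_eq_mul, Matrix.cons_val_zero,
        Matrix.cons_val_one, Matrix.head_cons, Matrix.cons_val_two, Matrix.tail_cons, Fin.isValue,
        Fin.zero_eta, Fin.mk_one, Fin.reduceFinMk] <;>
      [rw [← e0]; rw [← e1]; rw [← e2]] <;> push_cast <;> field_simp <;> rw [hs] <;> ring


/-- Cube vertices have norm² `3`. -/
theorem cubeVec_dot_self (c : Fin 8) : cubeVec c ⬝ᵥ cubeVec c = 3 := by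
  fin_cases c <;> simp [cubeVec, cubeInt, dotProduct, Fin.sum_univ_three] <;> norm_num

/-- Antipodal indexing of the cube vertices (integer table, kernel-decided). -/
theorem cubeInt_antipode : ∀ c c' : Fin 8, c'.val = 7 - c.val → cubeInt c' = -cubeInt c := by
  decide +kernel

/-- Antipodal indexing of the cube vertices. -/
theorem cubeVec_antipode (c c' : Fin 8) (h : c'.val = 7 - c.val) : cubeVec c' = -cubeVec c := by
  have hi := cubeInt_antipode c c' h
  ext i
  have := congrFun hi i
  simp only [Pi.neg_apply] at this
  simp only [cubeVec, Pi.neg_apply, this]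
  push_cast; ring

/-- `a ⬝ a = 0` forces `a = 0` (on `Fin 3 → ℝ`). -/
theorem eq_zero_of_dot_self_eq_zero3 (a : Fin 3 → ℝ) (h : a ⬝ᵥ a = 0) : a = 0 := by
  simp only [dotProduct, Fin.sum_univ_three] at h
  have h0 : a 0 = 0 := by nlinarith [mul_self_nonneg (a 0), mul_self_nonneg (a 1), mul_self_nonneg (a 2)]
  have h1 : a 1 = 0 := by nlinarith [mul_self_nonneg (a 0), mul_self_nonneg (a 1), mul_self_nonneg (a 2)]
  have h2 : a 2 = 0 := by nlinarith [mul_self_nonneg (a 0), mul_self_nonneg (a 1), mul_self_nonneg (a 2)]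
  ext i; fin_cases i <;> assumption

/-- **Tetrahedral frame inequality for the cube tetrahedra.**  For every `a ∈ ℝ³` one of the four
vertices `t` of the regular tetrahedron `T₁ = {0,3,5,6}` (resp. `T₂ = {7,4,2,1}`) of the cube satisfies
`a ⬝ t ≥ 0` and `|a|² ≤ 3 (a ⬝ t)²` (i.e. `∠(a, t) ≤ arccos(1/√3)·…`: `a ⬝ t̂ ≥ |a|/3`). -/
theorem tetra_cube (a : Fin 3 → ℝ) (T : List (Fin 8)) (hT : T = [0, 3, 5, 6] ∨ T = [7, 4, 2, 1]) :
    ∃ c ∈ T, 0 ≤ a ⬝ᵥ cubeVec c ∧ a ⬝ᵥ a ≤ 3 * (a ⬝ᵥ cubeVec c) ^ 2 := by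
  -- the four inner products
  have main : ∀ c₁ c₂ c₃ c₄ : Fin 8, T = [c₁, c₂, c₃, c₄] →
      (a ⬝ᵥ cubeVec c₁) + (a ⬝ᵥ cubeVec c₂) + (a ⬝ᵥ cubeVec c₃) + (a ⬝ᵥ cubeVec c₄) = 0 →
      (a ⬝ᵥ cubeVec c₁) ^ 2 + (a ⬝ᵥ cubeVec c₂) ^ 2 + (a ⬝ᵥ cubeVec c₃) ^ 2 + (a ⬝ᵥ cubeVec c₄) ^ 2 =
        4 * (a ⬝ᵥ a) →
      ∃ c ∈ T, 0 ≤ a ⬝ᵥ cubeVec c ∧ a ⬝ᵥ a ≤ 3 * (a ⬝ᵥ cubeVec c) ^ 2 := by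
    intro c₁ c₂ c₃ c₄ hTe hsum hsq
    set M := Real.sqrt ((a ⬝ᵥ a) / 3) with hM
    have haa : 0 ≤ a ⬝ᵥ a := by rw [dot_self_eq_sum_sq]; exact Finset.sum_nonneg fun i _ => sq_nonneg _
    have hM0 : 0 ≤ M := Real.sqrt_nonneg _
    have hM2 : M ^ 2 = (a ⬝ᵥ a) / 3 := by rw [hM, Real.sq_sqrt (by positivity)]
    have low : ∀ c : Fin 8, -(3 * M) ≤ a ⬝ᵥ cubeVec c := by
      intro c
      have hcs := cs3 a (cubeVec c)
      rw [← dot_self_eq_sum_sq, ← dot_self_eq_sum_sq, cubeVec_dot_self] at hcs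
      have h9 : (a ⬝ᵥ cubeVec c) ^ 2 ≤ (3 * M) ^ 2 := by nlinarith [hcs, hM2]
      exact (abs_le_of_sq_le_sq' h9 (by positivity)).1
    have key := tetra4 _ _ _ _ M hM0 hsum (by rw [hsq]; nlinarith [hM2]) (low c₁) (low c₂) (low c₃) (low c₄)
    have concl : ∀ c : Fin 8, c ∈ T → M ≤ a ⬝ᵥ cubeVec c →
        ∃ c ∈ T, 0 ≤ a ⬝ᵥ cubeVec c ∧ a ⬝ᵥ a ≤ 3 * (a ⬝ᵥ cubeVec c) ^ 2 := by
      intro c hc hle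
      refine ⟨c, hc, le_trans hM0 hle, ?_⟩
      have : M ^ 2 ≤ (a ⬝ᵥ cubeVec c) ^ 2 := by nlinarith [hle, hM0]
      nlinarith [this, hM2]
    rcases key with h | h | h | h
    · exact concl c₁ (by rw [hTe]; simp) h
    · exact concl c₂ (by rw [hTe]; simp) h
    · exact concl c₃ (by rw [hTe]; simp) h
    · exact concl c₄ (by rw [hTe]; simp) h
  rcases hT with rfl | rfl
  · apply main 0 3 5 6 rfl <;>
      simp [cubeVec, cubeInt, dotProduct, Fin.sum_univ_three] <;> ring
  · apply main 7 4 2 1 rfl <;>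
      simp [cubeVec, cubeInt, dotProduct, Fin.sum_univ_three] <;> ring


/-- The two cube tetrahedra are disjoint (table fact). -/
theorem tetra_disjoint : ∀ c ∈ ([0, 3, 5, 6] : List (Fin 8)), ∀ d ∈ ([7, 4, 2, 1] : List (Fin 8)), c ≠ d := by
  decide

/-- **Antiprism case.**  If the cube vertices `v₀ ∈ T`, `v₁ ∈ T'` are antipodal (`T, T'` the two
tetrahedra), then for every `a` some cube vertex OTHER than `v₀, v₁` satisfies `a ⬝ t ≥ 0`,
`|a|² ≤ 3 (a ⬝ t)²` (apply the tetrahedral inequality to both tetrahedra; if both single out the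
antipodal pair then `a ⬝ v₀ = 0`, `a = 0`, and any vertex works). -/
theorem antiprism_cube (a : Fin 3 → ℝ) (v₀ v₁ : Fin 8) (hneg : cubeVec v₁ = -cubeVec v₀)
    (T T' : List (Fin 8)) (hTT' : (T = [0, 3, 5, 6] ∧ T' = [7, 4, 2, 1]) ∨ (T = [7, 4, 2, 1] ∧ T' = [0, 3, 5, 6]))
    (hv₀ : v₀ ∈ T) (hv₁ : v₁ ∈ T') :
    ∃ c : Fin 8, c ≠ v₀ ∧ c ≠ v₁ ∧ 0 ≤ a ⬝ᵥ cubeVec c ∧ a ⬝ᵥ a ≤ 3 * (a ⬝ᵥ cubeVec c) ^ 2 := by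
  have hdisj := tetra_disjoint
  -- disjointness and "another vertex" in the orientation given by `hTT'`
  have hdis : ∀ c ∈ T, ∀ d ∈ T', c ≠ d := by
    rcases hTT' with ⟨rfl, rfl⟩ | ⟨rfl, rfl⟩
    · exact hdisj
    · intro c hc d hd h; exact hdisj d hd c hc h.symm
  have hexT : ∃ d ∈ T, d ≠ v₀ := by
    rcases hTT' with ⟨rfl, -⟩ | ⟨rfl, -⟩
    · by_cases h : v₀ = 0
      · exact ⟨3, by simp, by rw [h]; decide⟩
      · exact ⟨0, by simp, fun e => h e.symm⟩
    · by_cases h : v₀ = 7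
      · exact ⟨4, by simp, by rw [h]; decide⟩
      · exact ⟨7, by simp, fun e => h e.symm⟩
  have hT : T = [0, 3, 5, 6] ∨ T = [7, 4, 2, 1] := by
    rcases hTT' with ⟨h, -⟩ | ⟨h, -⟩ <;> simp [h]
  have hT' : T' = [0, 3, 5, 6] ∨ T' = [7, 4, 2, 1] := by
    rcases hTT' with ⟨-, h⟩ | ⟨-, h⟩ <;> simp [h]
  obtain ⟨c, hc, h0, h3⟩ := tetra_cube a T hT
  by_cases hcv : c = v₀
  · subst hcv
    obtain ⟨c', hc', h0', h3'⟩ := tetra_cube a T' hT'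
    by_cases hcv' : c' = v₁
    · subst hcv'
      -- both antipodes are good: `a ⬝ v₀ = 0`, hence `a = 0`
      rw [hneg, dotProduct_neg] at h0'
      have hz : a ⬝ᵥ cubeVec c = 0 := le_antisymm (by linarith) h0
      rw [hz] at h3
      have ha : a = 0 := eq_zero_of_dot_self_eq_zero3 a (le_antisymm (by linarith)
        (by rw [dot_self_eq_sum_sq]; exact Finset.sum_nonneg fun i _ => sq_nonneg _))
      obtain ⟨d, hd, hdv⟩ := hexT
      refine ⟨d, hdv, hdis d hd c' hc', ?_, ?_⟩
      · rw [ha, zero_dotProduct]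
      · rw [ha, zero_dotProduct, zero_dotProduct]; norm_num
    · exact ⟨c', fun h => hdis c hc c' hc' h.symm, hcv', h0', h3'⟩
  · exact ⟨c, hcv, hdis c hc v₁ hv₁, h0, h3⟩

/-- **NEAR-IDENTITY CAP LEMMA (cubic frame, matrix form; module M7 of the rigid rung at Σ1).**
Let `1 + κ` be a real orthogonal `3 × 3` matrix with `0 < ‖κ‖_F² ≤ 1/9` (a non-trivial rotation by
at most `≈ 13.5°`, or an improper isometry that close to `1` — there is none), and let `S ⊆ Fin 12` be
an own-set of slots with `3 ≤ #S ≤ 9`.  Then some OCCUPIED slot `o ∈ S` and some EMPTY slot `w ∉ S`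
ADJACENT to it (`o ⬝ w = ½`) satisfy `o ⬝ (1 + κ) w > ½`: the foreign ball sitting on the rotated copy
of the empty slot `w` overlaps the own ball on `o`.  Hence there is no mixed kissing dozen
`S ∪ (1+κ)(Fin 12 ∖ S)` for such `κ` — the first-order rigidity of the cuboctahedron with the exact
margin `1/(2√3)` of M7-CERT, made quantitative by the second-order bound `½‖κ‖_F²`. -/
theorem near_identity_cut (κ : Matrix (Fin 3) (Fin 3) ℝ)
    (horth : ∀ i j, κ i j + κ j i + ∑ l, κ l i * κ l j = 0)
    (hpos : 0 < (∑ i, ∑ j, κ i j ^ 2)) (hsmall : (∑ i, ∑ j, κ i j ^ 2) ≤ 1 / 9)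
    (S : Finset (Fin 12)) (h3 : 3 ≤ S.card) (h9 : S.card ≤ 9) :
    ∃ o ∈ S, ∃ w : Fin 12, w ∉ S ∧ slotVec o ⬝ᵥ slotVec w = 1 / 2 ∧
      1 / 2 < slotVec o ⬝ᵥ ((1 + κ) *ᵥ slotVec w) := by
  -- the axis of the skew part of `κ`
  set a : Fin 3 → ℝ := ![(κ 2 1 - κ 1 2) / 2, (κ 0 2 - κ 2 0) / 2, (κ 1 0 - κ 0 1) / 2] with ha
  -- a cut normal `c` present for `S` and "good" for `a` gives the conclusion
  have finish : ∀ c : Fin 8, c ∈ cutList S → 0 ≤ a ⬝ᵥ cubeVec c →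
      a ⬝ᵥ a ≤ 3 * (a ⬝ᵥ cubeVec c) ^ 2 →
      ∃ o ∈ S, ∃ w : Fin 12, w ∉ S ∧ slotVec o ⬝ᵥ slotVec w = 1 / 2 ∧
        1 / 2 < slotVec o ⬝ᵥ ((1 + κ) *ᵥ slotVec w) := by
    intro c hc h0 h3'
    obtain ⟨o, w, ht, ho, hw⟩ := mem_cutList hc
    obtain ⟨hd, hx⟩ := cut_real ht
    refine ⟨o, ho, w, hw, hd, ?_⟩
    have hm : a ⬝ᵥ crossProduct (slotVec w) (slotVec o) = (a ⬝ᵥ cubeVec c) / 2 := by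
      rw [hx, dotProduct_smul, smul_eq_mul]; ring
    have hp := dot_mulVec_pos κ horth a ha hpos hsmall (slotVec o) (slotVec w) (slotVec_dot_self o)
      (slotVec_dot_self w) (by rw [hm]; linarith) (by rw [hm]; nlinarith [h3'])
    rw [Matrix.add_mulVec, Matrix.one_mulVec, dotProduct_add, hd]
    linarith
  rcases good_all S h3 h9 with hT | hT | ⟨v, hv⟩
  · obtain ⟨c, hc, h0, h3'⟩ := tetra_cube a [0, 3, 5, 6] (Or.inl rfl)
    exact finish c (hT c hc) h0 h3'
  · obtain ⟨c, hc, h0, h3'⟩ := tetra_cube a [7, 4, 2, 1] (Or.inr rfl)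
    exact finish c (hT c hc) h0 h3'
  · -- antiprism about the axis `v`: cube vertices `v₀ = v`, `v₁ = 7 − v`
    set v₀ : Fin 8 := ⟨v.val, by omega⟩ with hv₀
    set v₁ : Fin 8 := ⟨7 - v.val, by omega⟩ with hv₁
    have hneg : cubeVec v₁ = -cubeVec v₀ := cubeVec_antipode v₀ v₁ (by simp [hv₀, hv₁])
    have hmem : ∃ T T' : List (Fin 8), ((T = [0, 3, 5, 6] ∧ T' = [7, 4, 2, 1]) ∨
        (T = [7, 4, 2, 1] ∧ T' = [0, 3, 5, 6])) ∧ v₀ ∈ T ∧ v₁ ∈ T' := by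
      fin_cases v
      · exact ⟨[0, 3, 5, 6], [7, 4, 2, 1], Or.inl ⟨rfl, rfl⟩, by simp [hv₀], by simp [hv₁]⟩
      · exact ⟨[7, 4, 2, 1], [0, 3, 5, 6], Or.inr ⟨rfl, rfl⟩, by simp [hv₀], by simp [hv₁]⟩
      · exact ⟨[7, 4, 2, 1], [0, 3, 5, 6], Or.inr ⟨rfl, rfl⟩, by simp [hv₀], by simp [hv₁]⟩
      · exact ⟨[0, 3, 5, 6], [7, 4, 2, 1], Or.inl ⟨rfl, rfl⟩, by simp [hv₀], by simp [hv₁]⟩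
    obtain ⟨T, T', hTT', hvT, hvT'⟩ := hmem
    obtain ⟨c, hc₀, hc₁, h0, h3'⟩ := antiprism_cube a v₀ v₁ hneg T T' hTT' hvT hvT'
    exact finish c (hv c (fun h => hc₀ (Fin.ext h)) (fun h => hc₁ (Fin.ext h))) h0 h3'

end Summit.Ventures.Crystal3D.Theorems.NearIdentity

end
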